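import Summits.BirchSwinnertonDyer.BirchSwinnertonDyer.Theorems.EisensteinPrimesPadicPiKernel
import HarnessLib

/-!
# Route `EisensteinPrimes` (rung K5), crux 2 `GoodLatticeBDPValue`, line `halves` v8, stub
# `stub_locallyTrivialOverTower`, brick F5(iii-c): CLOSED SUBGROUPS OF THE PRIME-TO-`p` PART OF `Ẑ`
# HAVE OPEN SUBGROUPS OF INDEX PRIME TO `p` (helper for stmt-BirchSwinnertonDyer-19032)

Cell `bsd-eis`, seat `bsd-eis-k5-c2` (gen 9). The `v̄`-half of the displayed stub needs the index
statement of `…PadicPiKernel.coprime_index_of_isOpen_of_le_ker` for an arbitrary CLOSED subgroup `Q`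
of the kernel of ONE non-zero continuous character `χ : ∏_ℓ ℤ_ℓ → ℤ_p` (at `v̄` the image of
`Gal(K̄_{v̄}/K̃_{∞,η})` in `Gal(K_{v̄}^nr/K_{v̄}) ≅ Ẑ` is only a closed subgroup of `ker χ̄₃`, `χ₃` the
`ℤ_p`-extension of `K` unramified at `v̄`):
* `exists_nsmul_mem_of_isOpen_padicPi'` — the SET version of p547817's box lemma (an open
  neighbourhood of `0`, not necessarily a subgroup);
* **`coprime_index_of_isOpen_of_isClosed_le_ker`** — for `χ ≠ 0` continuous, `Q ≤ ker χ` closed and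
  `V` open in `Q`: `p ∤ [Q : V ⊓ Q]` (`m • Q ⊆ V` with `p ∤ m`, Cauchy).
Theorems only; no definition, no named fact, no instance, no `sorry`. HONEST FRAMING: closes nothing
by itself (`--supports`). References: [SerreGaloisCohomology1997] I §1.4; [RibesZalesskii2010] §2.3.
-/

set_option autoImplicit false
set_option linter.dupNamespace false

noncomputable section

open scoped Classical

namespace Summit.BirchSwinnertonDyer.BirchSwinnertonDyer.Theorems.GreenbergFullAtSelmer

/-- SET version of `exists_nsmul_mem_of_isOpen_padicPi`: an open neighbourhood `U` of `0` in
`∏_ℓ ℤ_ℓ` swallows `m • x`, `p ∤ m`, as soon as `x_p ∈ p^k ℤ_p`. [cite: SerreGaloisCohomology1997, I §1.4] -/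
theorem exists_nsmul_mem_of_isOpen_padicPi' (U : Set (∀ q : Nat.Primes, @PadicInt (q : ℕ) ⟨q.2⟩))
    (hU : IsOpen U) (h0 : (0 : ∀ q : Nat.Primes, @PadicInt (q : ℕ) ⟨q.2⟩) ∈ U) (p₀ : Nat.Primes) :
    ∃ (k m : ℕ), ¬ (p₀ : ℕ) ∣ m ∧ 0 < m ∧ ∀ x : (∀ q : Nat.Primes, @PadicInt (q : ℕ) ⟨q.2⟩),
      x p₀ ∈ Ideal.span {((p₀ : ℕ) : @PadicInt (p₀ : ℕ) ⟨p₀.2⟩) ^ k} → m • x ∈ U := by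
  obtain ⟨I, u, hu, hsub⟩ := isOpen_pi_iff.mp hU 0 h0
  have hn : ∀ a : Nat.Primes, ∃ n : ℕ, a ∈ I → ∀ y : @PadicInt (a : ℕ) ⟨a.2⟩,
      y ∈ Ideal.span {((a : ℕ) : @PadicInt (a : ℕ) ⟨a.2⟩) ^ n} → y ∈ u a := by
    intro a
    by_cases ha : a ∈ I
    · haveI : Fact (a : ℕ).Prime := ⟨a.2⟩
      obtain ⟨n, hn⟩ := PadicInt.exists_span_pow_subset_of_isOpen (hu a ha).1 (hu a ha).2
      exact ⟨n, fun _ ↦ hn⟩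
    · exact ⟨0, fun h ↦ (ha h).elim⟩
  choose n hn using hn
  refine ⟨n p₀, ∏ a ∈ I.erase p₀, (a : ℕ) ^ n a, ?_, ?_, fun x hx ↦ hsub ?_⟩
  · intro hdvd
    have hp : (p₀ : ℕ).Prime := p₀.2
    obtain ⟨a, ha, hpa⟩ := (Prime.dvd_finsetProd_iff hp.prime _).mp hdvd
    have hpa' : (p₀ : ℕ) ∣ (a : ℕ) := hp.dvd_of_dvd_pow hpa
    have : (p₀ : ℕ) = a := (Nat.prime_dvd_prime_iff_eq hp a.2).mp hpa'
    exact (Finset.mem_erase.mp ha).1 (Subtype.ext this).symm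
  · exact Finset.prod_pos fun a _ ↦ pow_pos a.2.pos _
  · intro a ha
    change ((∏ a ∈ I.erase p₀, (a : ℕ) ^ n a) • x) a ∈ u a
    rw [Pi.smul_apply]
    haveI : Fact (a : ℕ).Prime := ⟨a.2⟩
    refine hn a ha _ ?_
    rw [nsmul_eq_mul]
    by_cases hap : a = p₀
    · subst hap
      exact Ideal.mul_mem_left _ _ hx
    · have hdvd : (a : ℕ) ^ n a ∣ ∏ a ∈ I.erase p₀, (a : ℕ) ^ n a :=
        Finset.dvd_prod_of_mem _ (Finset.mem_erase.mpr ⟨hap, ha⟩)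
      obtain ⟨c, hc⟩ := hdvd
      refine Ideal.mul_mem_right _ _ ?_
      rw [hc, Nat.cast_mul, Nat.cast_pow]
      exact Ideal.mul_mem_right _ _ (Ideal.mem_span_singleton_self _)

/-- **Closed subgroups of the prime-to-`p` part of `Ẑ` are pro-prime-to-`p`.** For a non-zero
continuous `χ : ∏_ℓ ℤ_ℓ → ℤ_p`, a CLOSED subgroup `Q ≤ ker χ` (`= {x : x_p = 0}`) and a subgroup `V`
whose trace on `Q` is open in `Q`: `[Q : V ⊓ Q]` is prime to `p`. [cite: SerreGaloisCohomology1997, I §1.4]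
[cite: RibesZalesskii2010, §2.3] -/
theorem coprime_index_of_isOpen_of_isClosed_le_ker (p₀ : Nat.Primes)
    (χ : (∀ q : Nat.Primes, @PadicInt (q : ℕ) ⟨q.2⟩) →+ @PadicInt (p₀ : ℕ) ⟨p₀.2⟩)
    (hχ : Continuous χ) (hne : ∃ y, χ y ≠ 0)
    (Q : AddSubgroup (∀ q : Nat.Primes, @PadicInt (q : ℕ) ⟨q.2⟩)) (hQ : Q ≤ χ.ker)
    (hQc : IsClosed (Q : Set (∀ q : Nat.Primes, @PadicInt (q : ℕ) ⟨q.2⟩)))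
    (V : AddSubgroup (∀ q : Nat.Primes, @PadicInt (q : ℕ) ⟨q.2⟩))
    (hVopen : IsOpen (((↑) : ↥Q → (∀ q : Nat.Primes, @PadicInt (q : ℕ) ⟨q.2⟩)) ⁻¹'
      (V : Set (∀ q : Nat.Primes, @PadicInt (q : ℕ) ⟨q.2⟩)))) :
    Nat.Coprime (p₀ : ℕ) (V.addSubgroupOf Q).index := by
  haveI : Fact (p₀ : ℕ).Prime := ⟨p₀.2⟩
  have hmemQ : ∀ x ∈ Q, x p₀ = 0 := fun x hx ↦ by
    obtain ⟨y, hy⟩ := hne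
    exact (mem_ker_inf_ker_iff_apply_eq_zero p₀ χ χ hχ hχ ⟨y, Or.inl hy⟩ x).mp
      (AddSubgroup.mem_inf.mpr ⟨hQ hx, hQ hx⟩)
  -- an open `O ⊆ ∏ ℤ_ℓ` with `Q ∩ O = Q ∩ V`, and the box lemma for it
  obtain ⟨O, hO, hOV⟩ := isOpen_induced_iff.mp hVopen
  have h0 : (0 : ∀ q : Nat.Primes, @PadicInt (q : ℕ) ⟨q.2⟩) ∈ O := by
    have : (0 : Q) ∈ ((↑) : ↥Q → _) ⁻¹' O := by rw [hOV]; exact V.zero_mem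
    exact this
  obtain ⟨k, m, hpm, hm0, hmO⟩ := exists_nsmul_mem_of_isOpen_padicPi' O hO h0 p₀
  have hmV : ∀ x : Q, m • x ∈ V.addSubgroupOf Q := by
    intro x
    have hx0 : (x : ∀ q : Nat.Primes, @PadicInt (q : ℕ) ⟨q.2⟩) p₀ ∈
        Ideal.span {((p₀ : ℕ) : @PadicInt (p₀ : ℕ) ⟨p₀.2⟩) ^ k} := by
      rw [hmemQ x x.2]; exact Ideal.zero_mem _
    have h := hmO x hx0
    have h' : (m • x : Q) ∈ ((↑) : ↥Q → _) ⁻¹' O := by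
      change ((m • x : Q) : ∀ q : Nat.Primes, @PadicInt (q : ℕ) ⟨q.2⟩) ∈ O
      rwa [AddSubgroupClass.coe_nsmul]
    rw [hOV] at h'
    exact h'
  -- finiteness and Cauchy
  haveI : CompactSpace Q := isCompact_iff_compactSpace.mp hQc.isCompact
  haveI : Finite (Q ⧸ V.addSubgroupOf Q) := AddSubgroup.quotient_finite_of_isOpen _ hVopen
  letI := Fintype.ofFinite (Q ⧸ V.addSubgroupOf Q)
  rw [Nat.Prime.coprime_iff_not_dvd p₀.2, AddSubgroup.index_eq_card, Nat.card_eq_fintype_card]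
  intro hdvd
  obtain ⟨q, hq⟩ := exists_prime_addOrderOf_dvd_card (p₀ : ℕ) hdvd
  induction q using QuotientAddGroup.induction_on with
  | H x =>
    have hmx : m • (x : Q ⧸ V.addSubgroupOf Q) = 0 := by
      rw [← QuotientAddGroup.mk_nsmul, QuotientAddGroup.eq_zero_iff]
      exact hmV x
    have hord : addOrderOf (x : Q ⧸ V.addSubgroupOf Q) ∣ m := addOrderOf_dvd_of_nsmul_eq_zero hmx
    rw [hq] at hord
    exact hpm hord

end Summit.BirchSwinnertonDyer.BirchSwinnertonDyer.Theorems.GreenbergFullAtSelmer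

end
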